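import Mathlib
import Literature.Analysis.FluidPDE.AncientMildCompactness
import Literature.Analysis.FluidPDE.KNSSTypeIRateLiouvilleMild
import Literature.Analysis.FluidPDE.GigaMiura2011ScaledAlignmentBlowupLimitHolds
import Literature.Analysis.FluidPDE.NSBoundedMildSmoothing
import HarnessLib

/-!
# decomp-ns lens 2, g20 — SX «SHADOW EXTRACTION», part 1/2: the ETERNAL EXTRACTION ENGINE

Split of the lens file HOME/decomp-ns-lens-2/TypeILiouvilleShadowExtraction.lean (sha256 93a3c1a0…, 545 lines, critic
row 230 CLEARED KERNEL) at its section boundary for the 400-line lint; this part is route-independent (no Theses import).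

* §A the exhaustion of space-time `ℝ × E` by the compact boxes `[−(n+2), n+2] × B̄(0, n+2)`;
* §B the ETERNAL extraction engine `exists_oseenMild_eternal_limit` (KNSS 2009 Lemma 6.1 with
  two-sided windows `(A_k, B_k)`, `A_k → −∞`, `B_k → +∞`): the tree's one-sided engine
  `exists_oseenMild_limit_of_monotone_bound` verbatim up to the windows.

Part 2 (`TypeILiouvilleShadowExtraction.lean`) proves §C `shadowExtraction_holds` = the registered stub
`stub_shadowExtraction` of `Cruxes/TypeIliouvilleL/Lines/quiescent-shadow.lean` (crux stmt-NavierStokesRegularity-10661) and the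
exact cut `(L) ⟺ EternalLiouville ∧ QuiescentLiouville` by name.

Sources: KNSS 2009 (arXiv:0709.3599) Lemma 6.1, proof of Thm 6.2 [KochNadirashviliSereginSverak2009];
Seregin 2014 lecture notes §6.4; Poláčik–Quittner–Souplet 2007; lens NODE-g20.md.
-/

set_option linter.dupNamespace false

noncomputable section

open MeasureTheory Filter Set Function Metric TopologicalSpace
open scoped Topology RealInnerProductSpace NNReal ENNReal
open Literature.Analysis Literature.Analysis.FluidPDE Literature.Analysis.UnboundedOperators

namespace Summit.NavierStokesRegularity.NavierStokesRegularity.Theorems.TypeILiouvilleShadowExtraction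

/-! ## §A The exhaustion of `ℝ × E` by the compact boxes `[−(n+2), n+2] × B̄(0, n+2)` -/

section Box

variable {E : Type*} [NormedAddCommGroup E]

/-- Membership in the box `[−(n+2), n+2] × B̄(0, n+2)`, unfolded. -/
theorem mem_boxPiece {n : ℕ} {z : ℝ × E} :
    z ∈ Icc (-((n : ℝ) + 2)) ((n : ℝ) + 2) ×ˢ closedBall (0 : E) ((n : ℝ) + 2) ↔
      (-((n : ℝ) + 2) ≤ z.1 ∧ z.1 ≤ (n : ℝ) + 2) ∧ ‖z.2‖ ≤ (n : ℝ) + 2 := by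
  simp [mem_prod, mem_Icc, mem_closedBall, dist_zero_right]

/-- The boxes are compact when `E` is proper. -/
theorem isCompact_boxPiece [ProperSpace E] (n : ℕ) :
    IsCompact (Icc (-((n : ℝ) + 2)) ((n : ℝ) + 2) ×ˢ closedBall (0 : E) ((n : ℝ) + 2)) :=
  isCompact_Icc.prod (isCompact_closedBall _ _)

/-- Every point of `ℝ × E` is interior to all large boxes. -/
theorem eventually_boxPiece_mem_nhds (t : ℝ) (x : E) :
    ∀ᶠ n : ℕ in atTop,
      Icc (-((n : ℝ) + 2)) ((n : ℝ) + 2) ×ˢ closedBall (0 : E) ((n : ℝ) + 2) ∈ 𝓝 (t, x) := by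
  have h1 : ∀ᶠ n : ℕ in atTop, |t| + 1 ≤ (n : ℝ) := tendsto_natCast_atTop_atTop.eventually_ge_atTop _
  have h3 : ∀ᶠ n : ℕ in atTop, ‖x‖ + 1 ≤ (n : ℝ) := tendsto_natCast_atTop_atTop.eventually_ge_atTop _
  filter_upwards [h1, h3] with n hn1 hn3
  have hta : -|t| ≤ t := neg_abs_le t
  have htb : t ≤ |t| := le_abs_self t
  have hbox : Ioo (t - 1) (t + 1) ×ˢ ball x 1 ⊆
      Icc (-((n : ℝ) + 2)) ((n : ℝ) + 2) ×ˢ closedBall (0 : E) ((n : ℝ) + 2) := by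
    intro z hz
    obtain ⟨⟨hz1, hz2⟩, hz3⟩ := hz
    rw [mem_ball] at hz3
    refine mem_boxPiece.2 ⟨⟨by linarith, by linarith⟩, ?_⟩
    calc ‖z.2‖ ≤ ‖x‖ + dist z.2 x := by
          have := norm_le_norm_add_norm_sub' z.2 x
          rwa [← dist_eq_norm] at this
      _ ≤ (n : ℝ) + 2 := by linarith
  refine Filter.mem_of_superset ?_ hbox
  exact prod_mem_nhds (Ioo_mem_nhds (by linarith) (by linarith)) (ball_mem_nhds x one_pos)

/-- Every point of `ℝ × E` lies in some box. -/
theorem exists_mem_boxPiece (t : ℝ) (x : E) :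
    ∃ n : ℕ, (t, x) ∈ Icc (-((n : ℝ) + 2)) ((n : ℝ) + 2) ×ˢ closedBall (0 : E) ((n : ℝ) + 2) := by
  obtain ⟨n, hn⟩ := (eventually_boxPiece_mem_nhds t x).exists
  exact ⟨n, mem_of_mem_nhds hn⟩

/-- A compact set of the form `{t} × K` lies in some box. -/
theorem exists_singleton_prod_subset_boxPiece (t : ℝ) {K : Set E} (hK : IsCompact K) :
    ∃ n : ℕ, ({t} : Set ℝ) ×ˢ K ⊆
      Icc (-((n : ℝ) + 2)) ((n : ℝ) + 2) ×ˢ closedBall (0 : E) ((n : ℝ) + 2) := by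
  obtain ⟨ρ, hρ⟩ := hK.isBounded.subset_closedBall 0
  have h1 : ∀ᶠ n : ℕ in atTop, |t| ≤ (n : ℝ) := tendsto_natCast_atTop_atTop.eventually_ge_atTop _
  have h3 : ∀ᶠ n : ℕ in atTop, ρ ≤ (n : ℝ) := tendsto_natCast_atTop_atTop.eventually_ge_atTop _
  obtain ⟨n, hn1, hn3⟩ := (h1.and h3).exists
  have hta : -|t| ≤ t := neg_abs_le t
  have htb : t ≤ |t| := le_abs_self t
  refine ⟨n, fun z hz => ?_⟩
  obtain ⟨hz1, hz2⟩ := hz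
  rw [mem_singleton_iff] at hz1
  have hz3 : ‖z.2‖ ≤ ρ := by simpa [mem_closedBall, dist_zero_right] using hρ hz2
  exact mem_boxPiece.2 ⟨⟨by rw [hz1]; linarith, by rw [hz1]; linarith⟩, hz3.trans (by linarith)⟩

variable {Y : Type*} [UniformSpace Y]

/-- **Continuity of the limit on `ℝ × E`.** If `V j → W` uniformly on every box and each `V j` is
eventually continuous on every box, then `W` is continuous. -/
theorem continuous_of_tendstoUniformlyOn_boxPiece {ι : Type*} {p : Filter ι} [p.NeBot]
    {V : ι → ℝ × E → Y} {W : ℝ × E → Y}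
    (hV : ∀ n : ℕ, ∀ᶠ j in p, ContinuousOn (V j)
      (Icc (-((n : ℝ) + 2)) ((n : ℝ) + 2) ×ˢ closedBall (0 : E) ((n : ℝ) + 2)))
    (hW : ∀ n : ℕ, TendstoUniformlyOn V W p
      (Icc (-((n : ℝ) + 2)) ((n : ℝ) + 2) ×ˢ closedBall (0 : E) ((n : ℝ) + 2))) :
    Continuous W := by
  rw [continuous_iff_continuousAt]
  rintro ⟨t, x⟩
  obtain ⟨n, hn⟩ := (eventually_boxPiece_mem_nhds (E := E) t x).exists
  have hc : ContinuousOn W _ := (hW n).continuousOn (hV n).frequently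
  exact hc.continuousAt hn

/-- **Pointwise convergence on `ℝ × E`** from uniform convergence on the boxes. -/
theorem tendsto_of_tendstoUniformlyOn_boxPiece {ι : Type*} {p : Filter ι}
    {V : ι → ℝ × E → Y} {W : ℝ × E → Y}
    (hW : ∀ n : ℕ, TendstoUniformlyOn V W p
      (Icc (-((n : ℝ) + 2)) ((n : ℝ) + 2) ×ˢ closedBall (0 : E) ((n : ℝ) + 2)))
    (t : ℝ) (x : E) :
    Tendsto (fun j => V j (t, x)) p (𝓝 (W (t, x))) := by
  obtain ⟨n, hn⟩ := exists_mem_boxPiece (E := E) t x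
  exact (hW n).tendsto_at hn

/-- **Slice-wise locally uniform convergence** from uniform convergence on the boxes. -/
theorem tendstoLocallyUniformly_slice_of_tendstoUniformlyOn_boxPiece [ProperSpace E] {ι : Type*}
    {p : Filter ι} {V : ι → ℝ × E → Y} {W : ℝ × E → Y}
    (hW : ∀ n : ℕ, TendstoUniformlyOn V W p
      (Icc (-((n : ℝ) + 2)) ((n : ℝ) + 2) ×ˢ closedBall (0 : E) ((n : ℝ) + 2)))
    (t : ℝ) :
    TendstoLocallyUniformly (fun j x => V j (t, x)) (fun x => W (t, x)) p := by
  rw [tendstoLocallyUniformly_iff_forall_isCompact]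
  intro K hK
  obtain ⟨n, hn⟩ := exists_singleton_prod_subset_boxPiece (E := E) t hK
  have h := (hW n).mono hn
  rw [tendstoUniformlyOn_iff_tendsto] at h ⊢
  have hmap : Tendsto (fun q : ι × E => (q.1, (t, q.2))) (p ×ˢ 𝓟 K)
      (p ×ˢ 𝓟 (({t} : Set ℝ) ×ˢ K)) := by
    refine Tendsto.prodMk tendsto_fst ?_
    have : Tendsto (fun q : ι × E => (t, q.2)) (p ×ˢ 𝓟 K) (𝓟 (({t} : Set ℝ) ×ˢ K)) := by
      rw [tendsto_principal]
      filter_upwards [tendsto_snd (f := p) (g := 𝓟 K) (mem_principal_self K)] with q hq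
      exact ⟨mem_singleton t, hq⟩
    exact this
  exact h.comp hmap

end Box

/-! ## §B The eternal extraction engine (KNSS 2009 Lemma 6.1 with two-sided windows) -/

section Engine

variable {E : Type*} [NormedAddCommGroup E] [InnerProductSpace ℝ E] [FiniteDimensional ℝ E]
  [MeasurableSpace E] [BorelSpace E]

/-- **Eternal extraction engine.** Let `w_k : ℝ → E → E` be continuous on the open slabs
`(A_k, B_k) × E` with `A_k → −∞`, `B_k → +∞`, with weakly divergence-free slices, satisfying the
Oseen integral identity `w_k(t) = e^{(t−s)Δ}w_k(s) − B¹_s(w_k, w_k)(t)` for all `A_k < s < t < B_k`,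
and `‖w_k‖ ≤ C` there. Then along a subsequence `w_{φ(j)} → W` uniformly on every box
`[−(n+2), n+2] × B̄(0, n+2)`, pointwise everywhere and locally uniformly on every time slice, where
`W` is continuous on `ℝ × E`, has weakly divergence-free slices, `‖W‖ ≤ C`, and satisfies the Oseen
identity for ALL `s < t` (an eternal bounded Oseen-mild field). Proof = the tree's one-sided engine
`exists_oseenMild_limit_of_monotone_bound` with two-sided windows: the uniform `1/4`-Hölder modulus
`exists_holder_quarter_of_oseenMild` on `[−(n+3), n+2] ⊂ (A_k, B_k)`, the diagonal Arzelà–Ascoli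
extraction `exists_strictMono_tendstoUniformlyOn_of_bound`, and dominated convergence
(`tendsto_heatExtension_of_tendsto_of_bound`, `tendsto_oseenDuhamel_of_tendsto_of_bound`). -/
theorem exists_oseenMild_eternal_limit {A B : ℕ → ℝ} {w : ℕ → ℝ → E → E} {C : ℝ}
    (hAlim : Tendsto A atTop atBot) (hBlim : Tendsto B atTop atTop)
    (hcont : ∀ k, ContinuousOn (uncurry (w k)) (Ioo (A k) (B k) ×ˢ univ))
    (hdiv : ∀ k, ∀ t ∈ Ioo (A k) (B k), IsWeaklyDivFree (w k t))
    (hmild : ∀ k, ∀ s t : ℝ, A k < s → s < t → t < B k → ∀ x,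
      w k t x = UnboundedOperators.heatExtension (w k s) (t - s) x -
        oseenDuhamel 1 s (w k) (w k) t x)
    (hbdd : ∀ k, ∀ τ ∈ Ioo (A k) (B k), ∀ x, ‖w k τ x‖ ≤ C) :
    ∃ (φ : ℕ → ℕ) (W : ℝ → E → E), StrictMono φ ∧
      Continuous (uncurry W) ∧
      (∀ t, IsWeaklyDivFree (W t)) ∧
      (∀ t x, ‖W t x‖ ≤ C) ∧
      (∀ s t : ℝ, s < t → ∀ x,
        W t x = UnboundedOperators.heatExtension (W s) (t - s) x - oseenDuhamel 1 s W W t x) ∧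
      (∀ n : ℕ, TendstoUniformlyOn (fun j => uncurry (w (φ j))) (uncurry W) atTop
        (Icc (-((n : ℝ) + 2)) ((n : ℝ) + 2) ×ˢ closedBall (0 : E) ((n : ℝ) + 2))) ∧
      (∀ t x, Tendsto (fun j => w (φ j) t x) atTop (𝓝 (W t x))) ∧
      (∀ t, TendstoLocallyUniformly (fun j => w (φ j) t) (W t) atTop) := by
  -- ## Step 1: per-`k` facts
  have hslice : ∀ k, ∀ t ∈ Ioo (A k) (B k), Continuous (w k t) := fun k t ht =>
    (hcont k).comp_continuous (Continuous.prodMk_right t) fun x => ⟨ht, mem_univ x⟩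
  -- eventually the slice lies in the domain
  have hdomA : ∀ t : ℝ, ∀ᶠ k in atTop, A k < t := fun t => hAlim.eventually (eventually_lt_atBot t)
  have hdomB : ∀ t : ℝ, ∀ᶠ k in atTop, t < B k := fun t => hBlim.eventually (eventually_gt_atTop t)
  -- nonnegativity of the bound (the domains are eventually nonempty)
  have hC0 : 0 ≤ C := by
    obtain ⟨k, hkA, hkB⟩ := ((hdomA 0).and (hdomB 0)).exists
    exact (norm_nonneg _).trans (hbdd k 0 ⟨hkA, hkB⟩ 0)
  -- ## Step 2: the uniform Hölder modulus on the boxes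
  obtain ⟨K₀, hK₀, hHold⟩ := exists_holder_quarter_of_oseenMild (E := E)
  set V : ℕ → ℝ × E → E := fun k z => w k z.1 z.2 with hV
  set T : ℕ → Set (ℝ × E) := fun n =>
    Icc (-((n : ℝ) + 2)) ((n : ℝ) + 2) ×ˢ closedBall (0 : E) ((n : ℝ) + 2) with hT
  have hVn : ∀ n : ℕ, ∀ᶠ k in atTop, ContinuousOn (V k) (T n) ∧
      (∀ z ∈ T n, ‖V k z‖ ≤ C) ∧
      ∀ z ∈ T n, ∀ z' ∈ T n,
        dist (V k z) (V k z') ≤ K₀ * (C + C ^ 2) * dist z z' ^ (1 / 4 : ℝ) := by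
    intro n
    filter_upwards [hdomA (-((n : ℝ) + 3)), hdomB ((n : ℝ) + 2)] with k hkA hkB
    -- the window `[a, b] = [−(n+3), n+2] ⊂ (A k, B k)`
    set a : ℝ := -((n : ℝ) + 3) with ha
    set b : ℝ := (n : ℝ) + 2 with hb
    have hIcc : ∀ t ∈ Icc a b, t ∈ Ioo (A k) (B k) := fun t ht =>
      ⟨hkA.trans_le ht.1, ht.2.trans_lt hkB⟩
    have hbR : ∀ t ∈ Icc a b, ∀ x, ‖w k t x‖ ≤ C := fun t ht x => hbdd k t (hIcc t ht) x
    have hmod := hHold hC0 (fun t ht => hslice k t (hIcc t ht)) hbR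
      (fun s t has hst htb x => hmild k s t (hkA.trans_le has) hst (htb.trans_lt hkB) x)
    have hpiece : ∀ z ∈ T n, z.1 ∈ Icc (a + 1) b := fun z hz => by
      obtain ⟨⟨h1, h2⟩, -⟩ := mem_boxPiece.1 hz
      exact ⟨by rw [ha]; linarith, by rw [hb]; exact h2⟩
    refine ⟨?_, fun z hz => ?_, fun z hz z' hz' => ?_⟩
    · refine (hcont k).mono fun z hz => ⟨?_, mem_univ _⟩
      have h := hpiece z hz
      exact hIcc z.1 ⟨by linarith [h.1], h.2⟩
    · have h := hpiece z hz
      exact hbR z.1 ⟨by linarith [h.1], h.2⟩ z.2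
    · have h := hmod z'.1 (hpiece z' hz') z.1 (hpiece z hz) z'.2 z.2
      rw [dist_eq_norm, Prod.dist_eq, Real.dist_eq, dist_eq_norm]
      exact h
  -- ## Step 3: extraction
  obtain ⟨φ, hφ, W₀, hW₀⟩ := exists_strictMono_tendstoUniformlyOn_of_bound
    (fun n => isCompact_boxPiece (E := E) n) (R := fun _ => C)
    (fun _ => mul_nonneg hK₀.le (add_nonneg hC0 (sq_nonneg _))) (fun _ => by norm_num) hVn
  have hφt : Tendsto φ atTop atTop := hφ.tendsto_atTop
  set W : ℝ → E → E := fun t x => W₀ (t, x) with hWdef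
  have hVφ : ∀ n, ∀ᶠ j in atTop, ContinuousOn (V (φ j)) (T n) := fun n =>
    (hφt.eventually (hVn n)).mono fun j hj => hj.1
  -- continuity of the limit on space-time
  have hWc : Continuous (uncurry W) := by
    have h := continuous_of_tendstoUniformlyOn_boxPiece hVφ hW₀
    exact h.congr fun z => rfl
  -- pointwise convergence everywhere
  have hpt : ∀ t x, Tendsto (fun j => w (φ j) t x) atTop (𝓝 (W t x)) := fun t x =>
    tendsto_of_tendstoUniformlyOn_boxPiece hW₀ t x
  -- eventually the slice lies in the domain
  have hdom : ∀ t : ℝ, ∀ᶠ j in atTop, A (φ j) < t := fun t =>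
    (hAlim.comp hφt).eventually (eventually_lt_atBot t)
  have hdom' : ∀ t : ℝ, ∀ᶠ j in atTop, t < B (φ j) := fun t =>
    (hBlim.comp hφt).eventually (eventually_gt_atTop t)
  have hWslice : ∀ t, Continuous (W t) := fun t =>
    hWc.comp (Continuous.prodMk_right t)
  refine ⟨φ, W, hφ, hWc, fun t => ?_, fun t x => ?_, fun s t hst x => ?_, ?_, hpt, fun t => ?_⟩
  · -- ## Step 4a: weak divergence-freeness of the limit slices
    intro θ hθ
    have hθ1 : ContDiff ℝ 1 θ := contDiff_infty.1 hθ.contDiff 1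
    have hgc : HasCompactSupport (gradient θ) := by
      have : gradient θ = (fun L => (InnerProductSpace.toDual ℝ E).symm L) ∘ fderiv ℝ θ := rfl
      rw [this]
      exact (hθ.hasCompactSupport.fderiv (𝕜 := ℝ)).comp_left (by simp)
    have hθi : Integrable (fun x => C * ‖gradient θ x‖) volume :=
      (((continuous_gradient_of_contDiff hθ1).integrable_of_hasCompactSupport hgc).norm).const_mul C
    have hlimθ : Tendsto (fun j => ∫ x, ⟪w (φ j) t x, gradient θ x⟫) atTop
        (𝓝 (∫ x, ⟪W t x, gradient θ x⟫)) := by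
      refine tendsto_integral_filter_of_dominated_convergence (fun x => C * ‖gradient θ x‖)
        ?_ ?_ hθi (Eventually.of_forall fun x => (hpt t x).inner tendsto_const_nhds)
      · filter_upwards [hdom t, hdom' t] with j hj hj'
        exact ((hslice (φ j) t ⟨hj, hj'⟩).inner
          (continuous_gradient_of_contDiff hθ1)).aestronglyMeasurable
      · filter_upwards [hdom t, hdom' t] with j hj hj'
        exact Eventually.of_forall fun x => (norm_inner_le_norm _ _).trans
          (mul_le_mul_of_nonneg_right (hbdd (φ j) t ⟨hj, hj'⟩ x) (norm_nonneg _))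
    have hzero : ∀ᶠ j in atTop, ∫ x, ⟪w (φ j) t x, gradient θ x⟫ = 0 := by
      filter_upwards [hdom t, hdom' t] with j hj hj'
      exact hdiv (φ j) t ⟨hj, hj'⟩ θ hθ
    exact tendsto_nhds_unique hlimθ (tendsto_const_nhds.congr' (hzero.mono fun j hj => hj.symm))
  · -- ## Step 4b: the bound `‖W‖ ≤ C`
    refine le_of_tendsto (hpt t x).norm ?_
    filter_upwards [hdom t, hdom' t] with j hj hj'
    exact hbdd (φ j) t ⟨hj, hj'⟩ x
  · -- ## Step 5: the Oseen identity in the limit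
    obtain ⟨k₀, hk₀⟩ := eventually_atTop.1 ((hdom s).and (hdom' t))
    set u : ℕ → ℝ → E → E := fun j => w (φ (j + k₀)) with hu
    have hAu : ∀ j, A (φ (j + k₀)) < s := fun j => (hk₀ _ (Nat.le_add_left _ _)).1
    have hBu : ∀ j, t < B (φ (j + k₀)) := fun j => (hk₀ _ (Nat.le_add_left _ _)).2
    have hshift : Tendsto (fun j => j + k₀) atTop atTop := tendsto_add_atTop_nat k₀
    -- bound on `(s, t)`
    have huM : ∀ j, ∀ τ ∈ Ioo s t, ∀ y, ‖u j τ y‖ ≤ C := fun j τ hτ y =>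
      hbdd _ τ ⟨(hAu j).trans hτ.1, hτ.2.trans (hBu j)⟩ y
    -- measurability
    have hum : ∀ j, AEStronglyMeasurable (uncurry (u j))
        ((volume : Measure (ℝ × E)).restrict (Ioo s t ×ˢ univ)) :=
      fun j => ((hcont _).mono (prod_mono
        (fun τ hτ => ⟨(hAu j).trans hτ.1, hτ.2.trans (hBu j)⟩) Subset.rfl)).aestronglyMeasurable
          (measurableSet_Ioo.prod MeasurableSet.univ)
    have hWm : AEStronglyMeasurable (uncurry W)
        ((volume : Measure (ℝ × E)).restrict (Ioo s t ×ˢ univ)) :=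
      hWc.continuousOn.aestronglyMeasurable (measurableSet_Ioo.prod MeasurableSet.univ)
    -- pointwise convergence along the shifted subsequence
    have hptu : ∀ τ y, Tendsto (fun j => u j τ y) atTop (𝓝 (W τ y)) := fun τ y =>
      (hpt τ y).comp hshift
    -- the Duhamel term
    have hD : Tendsto (fun j => oseenDuhamel 1 s (u j) (u j) t x) atTop
        (𝓝 (oseenDuhamel 1 s W W t x)) :=
      tendsto_oseenDuhamel_of_tendsto_of_bound one_pos hC0 hst hum hWm huM
        (fun τ _ y => hptu τ y) x
    -- the caloric term
    have hH : Tendsto (fun j => UnboundedOperators.heatExtension (u j s) (t - s) x) atTop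
        (𝓝 (UnboundedOperators.heatExtension (W s) (t - s) x)) := by
      refine tendsto_heatExtension_of_tendsto_of_bound (M := C)
        (fun j => (hslice _ s ⟨hAu j, hst.trans (hBu j)⟩).aestronglyMeasurable)
        (fun j z => hbdd _ s ⟨hAu j, hst.trans (hBu j)⟩ z) (hptu s) (sub_pos.2 hst) x
    -- the identity for each `j` and the limit
    have hid : (fun j => u j t x) = fun j =>
        UnboundedOperators.heatExtension (u j s) (t - s) x - oseenDuhamel 1 s (u j) (u j) t x :=
      funext fun j => hmild _ s t (hAu j) hst (hBu j) x
    have hlim2 : Tendsto (fun j => u j t x) atTop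
        (𝓝 (UnboundedOperators.heatExtension (W s) (t - s) x - oseenDuhamel 1 s W W t x)) := by
      rw [hid]; exact hH.sub hD
    exact tendsto_nhds_unique (hptu t x) hlim2
  · -- ## Step 3': uniform convergence on the boxes
    intro n
    exact (hW₀ n).congr (Eventually.of_forall fun j => eqOn_refl _ _)
  · -- ## Step 3'': slice-wise locally uniform convergence
    exact tendstoLocallyUniformly_slice_of_tendstoUniformlyOn_boxPiece hW₀ t

end Engine

end Summit.NavierStokesRegularity.NavierStokesRegularity.Theorems.TypeILiouvilleShadowExtraction

end
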